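import Summits.ABC.IUTFork.Cor312TeamAHonestCensusSlot
import Summits.ABC.IUTFork.Cor312PinnedRegionsThreePins
import HarnessLib

/-!
# [IUTchIII] Cor. 3.12 — the honest node census at the PINNED-REGIONS gap forms (GapA3 / GapH3 / PilotKummerIndRelated)

Record-only, proof-only companion (D-0012) of `Cor312TeamAHonestCensusSlot.lean` (p419206, abc-iut-w4-d021) for the
PINNED-REGIONS round (director-abc 01:56Z; plan/ADJUDICATION-SPEC v2.3 §2 (G-PINNED); PR-1 vocabulary of record =
abc-iut-w5-d230's `Cor312PinnedRegionsThreePins.lean` p418935: `PinnedRegions3` = (pΘ) ∧ (pq′) ∧ (pL), `GapA3`, `GapH3`,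
`PilotKummerIndRelated`, GAP row G-w5d230-1). S. Mochizuki, *Inter-universal Teichmüller theory III*, Cor. 3.12, (xi-e)/(xi-f)
p. 183 l. 43 – p. 184 l. 29 [cite: Mochizuki2012, III Cor 3.12 p.184]; claim key DISPUTED. TAKES NO SIDE; typed ≠ proved.

By `chain_at_iff` (p419206) the twenty-node chain, with every other observation read honestly, is TRANSPARENT to the
(xi-f) slot. Instantiated at the pinned round's gap forms:
* `chain_at_gapA3_iff` — `Chain L (honestReadingAt P C D L A (GapA3 S P ρ qK)) ↔ GapA3 S P ρ qK`;
* `chain_at_gapH3_iff` — the same for the hull-level form `GapH3`;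
* `chain_at_pilotKummerIndRelated_iff` — the same for the (LETTER-AT-PRINT-LEVEL) residual `PilotKummerIndRelated` (G-w5d230-1);
* `statement_of_pinned3_of_chain_at_gapA3` — under the three pins and the bridge hypotheses, the chain with `GapA3` at
  (xi-f) gives the printed `Statement` (`statement_of_gapA3`); `…_of_chain_at_pilotKummerIndRelated` likewise through
  `gapA3_iff` (needs Thm 3.11 (ii)(b) `KummerB` of the setting's column, as in w5-d230's file).
So for the pinned round too: the adjudication of the printed proof reduces, over the frozen definitions, to the
adjudication of the ONE proposition at (xi-f) — here the pinned residual that PR-1′ (derivation) and PR-2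
(countermodel) are deciding. Nothing here bears on which way that goes.
-/

namespace Summit.ABC

namespace IUTFork

namespace Cor312Proof

open Locus Obs Thm311 Cor312 Cor312Vol StepXI Literature.IUT.LogThetaLattice

variable {T : ThetaIndex} {S : LatticeSituation T} {P : Cor312.Setting S.toSituation}

/-- **The chain with the pinned IDENTIFICATION-level gap `GapA3` at (xi-f) holds IFF `GapA3`** (node-side inputs
granted). [claim: Mochizuki2012, status: disputed] -/
theorem chain_at_gapA3_iff (C : Column S.L) (D : ThetaLinkStrips P.LogLink P.Strip) (L : Locus → Prop)
    (A : InputStrip.StripAlgorithm P)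
    (ρ : (∀ v : T.V, v ∈ T.Vbad → Set (S.L.StarPacket v)) → ∀ (j : T.Label) (vQ : T.VQ), Set (S.L.Packet j vQ))
    (qK : ∀ v : T.V, v ∈ T.Vbad → Set (S.L.StarPacket v))
    (hIndAdm : ∀ Φ ∈ S.L.Ind1Family ∪ S.L.Ind2Family, ∀ (j : T.Label) (vQ : T.VQ)
      (X : Set (S.L.Packet j vQ)), (S.D P.n).Adm j vQ X ↔ (S.D P.n).Adm j vQ (Φ j vQ '' X))
    (hIndVol : (S.D P.n).LogvolInvariant)
    (hMono : ∀ (j : T.Label) (vQ : T.VQ) (X Y : Set (S.L.Packet j vQ)),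
      (S.D P.n).Adm j vQ X → (S.D P.n).Adm j vQ Y → X ⊆ Y →
        (S.D P.n).logvol j vQ X ≤ (S.D P.n).logvol j vQ Y)
    (hKumA : C.KummerA (S.D P.n))
    (hNE : ∀ n m : ℤ, Nonempty (P.IsoS (D.stripLGP (P.lattice.logLink n (m - 1)))
      (D.stripDelta (P.lattice.theater (n + 1) m))))
    (hfin : P.ThetaFinite) (hq : P.AbsLogQPos) :
    Chain L (honestReadingAt P C D L A (GapA3 S P ρ qK)) ↔ GapA3 S P ρ qK :=
  chain_at_iff C D L A _ hIndAdm hIndVol hMono hKumA hNE hfin hq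

/-- The same at the HULL-level pinned form `GapH3`. [claim: Mochizuki2012, status: disputed] -/
theorem chain_at_gapH3_iff (C : Column S.L) (D : ThetaLinkStrips P.LogLink P.Strip) (L : Locus → Prop)
    (A : InputStrip.StripAlgorithm P)
    (ρ : (∀ v : T.V, v ∈ T.Vbad → Set (S.L.StarPacket v)) → ∀ (j : T.Label) (vQ : T.VQ), Set (S.L.Packet j vQ))
    (qK : ∀ v : T.V, v ∈ T.Vbad → Set (S.L.StarPacket v))
    (hIndAdm : ∀ Φ ∈ S.L.Ind1Family ∪ S.L.Ind2Family, ∀ (j : T.Label) (vQ : T.VQ)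
      (X : Set (S.L.Packet j vQ)), (S.D P.n).Adm j vQ X ↔ (S.D P.n).Adm j vQ (Φ j vQ '' X))
    (hIndVol : (S.D P.n).LogvolInvariant)
    (hMono : ∀ (j : T.Label) (vQ : T.VQ) (X Y : Set (S.L.Packet j vQ)),
      (S.D P.n).Adm j vQ X → (S.D P.n).Adm j vQ Y → X ⊆ Y →
        (S.D P.n).logvol j vQ X ≤ (S.D P.n).logvol j vQ Y)
    (hKumA : C.KummerA (S.D P.n))
    (hNE : ∀ n m : ℤ, Nonempty (P.IsoS (D.stripLGP (P.lattice.logLink n (m - 1)))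
      (D.stripDelta (P.lattice.theater (n + 1) m))))
    (hfin : P.ThetaFinite) (hq : P.AbsLogQPos) :
    Chain L (honestReadingAt P C D L A (GapH3 S P ρ qK)) ↔ GapH3 S P ρ qK :=
  chain_at_iff C D L A _ hIndAdm hIndVol hMono hKumA hNE hfin hq

/-- The same at the (LETTER-AT-PRINT-LEVEL) residual of record (GAP row G-w5d230-1): the pins-imply-relatedness
statement `PinnedRegions3 → PilotKummerIndRelated`. [claim: Mochizuki2012, status: disputed] -/
theorem chain_at_pilotKummerIndRelated_iff (C : Column S.L) (D : ThetaLinkStrips P.LogLink P.Strip)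
    (L : Locus → Prop) (A : InputStrip.StripAlgorithm P)
    (ρ : (∀ v : T.V, v ∈ T.Vbad → Set (S.L.StarPacket v)) → ∀ (j : T.Label) (vQ : T.VQ), Set (S.L.Packet j vQ))
    (qK : ∀ v : T.V, v ∈ T.Vbad → Set (S.L.StarPacket v))
    (hIndAdm : ∀ Φ ∈ S.L.Ind1Family ∪ S.L.Ind2Family, ∀ (j : T.Label) (vQ : T.VQ)
      (X : Set (S.L.Packet j vQ)), (S.D P.n).Adm j vQ X ↔ (S.D P.n).Adm j vQ (Φ j vQ '' X))
    (hIndVol : (S.D P.n).LogvolInvariant)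
    (hMono : ∀ (j : T.Label) (vQ : T.VQ) (X Y : Set (S.L.Packet j vQ)),
      (S.D P.n).Adm j vQ X → (S.D P.n).Adm j vQ Y → X ⊆ Y →
        (S.D P.n).logvol j vQ X ≤ (S.D P.n).logvol j vQ Y)
    (hKumA : C.KummerA (S.D P.n))
    (hNE : ∀ n m : ℤ, Nonempty (P.IsoS (D.stripLGP (P.lattice.logLink n (m - 1)))
      (D.stripDelta (P.lattice.theater (n + 1) m))))
    (hfin : P.ThetaFinite) (hq : P.AbsLogQPos) :
    Chain L (honestReadingAt P C D L A (PinnedRegions3 S P ρ qK → PilotKummerIndRelated S P ρ qK)) ↔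
      (PinnedRegions3 S P ρ qK → PilotKummerIndRelated S P ρ qK) :=
  chain_at_iff C D L A _ hIndAdm hIndVol hMono hKumA hNE hfin hq

/-- **Under the three pins, the chain with `GapA3` at (xi-f) gives the printed `Statement`** (w5-d230's
`statement_of_gapA3` through the landed R3 bridge). [claim: Mochizuki2012, status: disputed] -/
theorem statement_of_pinned3_of_chain_at_gapA3 (H : BridgeHyps P) (C : Column S.L)
    (D : ThetaLinkStrips P.LogLink P.Strip) (L : Locus → Prop) (A : InputStrip.StripAlgorithm P)
    (ρ : (∀ v : T.V, v ∈ T.Vbad → Set (S.L.StarPacket v)) → ∀ (j : T.Label) (vQ : T.VQ), Set (S.L.Packet j vQ))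
    (qK : ∀ v : T.V, v ∈ T.Vbad → Set (S.L.StarPacket v)) (hpin : PinnedRegions3 S P ρ qK) (hq : P.AbsLogQPos)
    (hchain : Chain L (honestReadingAt P C D L A (GapA3 S P ρ qK))) : P.Statement :=
  statement_of_gapA3 S P ρ qK H hpin ((xi_f_holds_at_iff C D L A _ H.finite hq).mp (hchain .xi_f))

/-- … and with the print-level residual `PilotKummerIndRelated` at (xi-f), through `gapA3_iff` (needs Thm 3.11 (ii)(b)
`KummerB` of the setting's own column). [claim: Mochizuki2012, status: disputed] -/
theorem statement_of_pinned3_of_chain_at_pilotKummerIndRelated (H : BridgeHyps P)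
    (hKumB : (S.col P.n).KummerB (S.D P.n)) (C : Column S.L)
    (D : ThetaLinkStrips P.LogLink P.Strip) (L : Locus → Prop) (A : InputStrip.StripAlgorithm P)
    (ρ : (∀ v : T.V, v ∈ T.Vbad → Set (S.L.StarPacket v)) → ∀ (j : T.Label) (vQ : T.VQ), Set (S.L.Packet j vQ))
    (qK : ∀ v : T.V, v ∈ T.Vbad → Set (S.L.StarPacket v)) (hpin : PinnedRegions3 S P ρ qK) (hq : P.AbsLogQPos)
    (hchain : Chain L (honestReadingAt P C D L A (PinnedRegions3 S P ρ qK → PilotKummerIndRelated S P ρ qK))) :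
    P.Statement :=
  statement_of_gapA3 S P ρ qK H hpin
    ((gapA3_iff S P ρ qK hKumB).mpr ((xi_f_holds_at_iff C D L A _ H.finite hq).mp (hchain .xi_f)))

end Cor312Proof

end IUTFork

end Summit.ABC
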